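import Mathlib
import Literature.Analysis.FluidPDE.TypeIAncientMild
import Literature.Analysis.FluidPDE.OseenSlice
import HarnessLib

/-!
# Route SymmetryModuliCount — crux `HelicalEndLiouville` (stmt-NavierStokesRegularity-14062),
# line `vanishing-cell-reynolds`, stub 1: screw ⊃ lattice (`stub_helicalScrewPeriod`)

For a skew map `A` on `ℝ³` (`⟪A x, x⟫ = 0`) and a vector `a ∉ range A` there is ONE vector
`L ≠ 0` such that every differentiable field `f : ℝ³ → ℝ³` annihilated by the Killing generator
`(a + Ax)·∇ − A`, i.e. `Df(x)[a + A x] = A f(x)` for all `x`, is `L`-periodic.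

Proof (finite-dimensional linear algebra and one linear ODE, no fluid mechanics).
* `A = 0`: then `a ≠ 0`, `L = a`, and `Df(y)[a] = 0` integrates along the lines `x + r a`
  (`screwPeriod_eq_of_fderiv_apply_eq_zero`, mean value theorem `is_const_of_deriv_eq_zero`).
* `A ≠ 0`: polarising `⟪A x, x⟫ = 0` gives the matrix of `A` in the standard basis as
  `A x = ω × x` with three entries `p, q, r` (`screwPeriod_skew_apply`), whence Cayley–Hamilton
  `A³ = −ρ² A`, `ρ² = p² + q² + r² > 0` (`screwPeriod_skew_cube`). After the normalisation
  `B = A/ρ`, `b = a/ρ` (same symmetry condition, `B³ = −B`) Rodrigues' formula gives the screw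
  orbit `γ(θ) = x + θ b + sin θ · Bx + (1 − cos θ)(B²x + Bb) + (θ − sin θ) B²b` with
  `γ' = b + Bγ`, `γ(0) = x`, `γ(2π) = x + L`, `L = 2π (b + B²b)`; along it
  `w(θ) = f(γ θ) − R_θ f(x)` (`R_θ = 1 + sin θ B + (1 − cos θ) B²`) solves `w' = Bw`, `w(0) = 0`,
  and `‖w‖²` is constant because `B` is skew, so `f(x + L) = f(x)`
  (`screwPeriod_periodic_of_unit_screw`). Finally `L ≠ 0`: `L = 0` would give `b = −B²b`, i.e.
  `a = ρ b = A(−B b) ∈ range A`.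

Tree lemmas used: none beyond Mathlib (`EuclideanSpace.inner_single_right`, `PiLp.*_apply`,
`HasDerivAt.smul_const/.add/.inner`, `HasFDerivAt.comp_hasDerivAt`, `is_const_of_deriv_eq_zero`,
`Real.sin_two_pi`, `Real.cos_two_pi`, `match_scalars`/`module`). The ODE/energy pattern is
adapted from `Theorems/SymmetricLiouville/Negative/ScrewClause.lean` (`screw_equivariant`), the
translation case from `Cruxes/HelicalEndLiouville/Disproof.lean` (`eq_of_fderiv_apply_eq_zero`).
All statements are folklore (Rodrigues 1840; Chasles' screw theorem).
-/

noncomputable section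

-- the summit and its single sub-problem share the name (CONVENTIONS §1), as in every Theorems file
set_option linter.dupNamespace false

open Set MeasureTheory Function Filter
open Literature.Analysis.FluidPDE
open Literature.Analysis.UnboundedOperators (heatExtension)
open scoped RealInnerProductSpace Topology

namespace Summit.NavierStokesRegularity.NavierStokesRegularity.Theorems

local notation "E3" => EuclideanSpace ℝ (Fin 3)

/-- Infinitesimal ⇒ finite translation invariance along a line, for a differentiable field:
`Df(y)[a] = 0` for all `y` gives `f (x + r • a) = f x` (mean value theorem along the line).
[folklore] -/
theorem screwPeriod_eq_of_fderiv_apply_eq_zero {f : E3 → E3} (hf : Differentiable ℝ f) {a : E3}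
    (h : ∀ x, fderiv ℝ f x a = 0) (x : E3) (r : ℝ) : f (x + r • a) = f x := by
  -- adapted from Cruxes/HelicalEndLiouville/Disproof.lean (`eq_of_fderiv_apply_eq_zero`)
  set g : ℝ → E3 := fun r => f (x + r • a) with hg
  have hderiv : ∀ r, HasDerivAt g 0 r := by
    intro r
    have hp : HasDerivAt (fun r : ℝ => x + r • a) a r := by
      simpa using ((hasDerivAt_id r).smul_const a).const_add x
    have hcomp : HasDerivAt (f ∘ fun r : ℝ => x + r • a) (fderiv ℝ f (x + r • a) a) r :=
      (hf (x + r • a)).hasFDerivAt.comp_hasDerivAt r hp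
    rw [h (x + r • a)] at hcomp
    exact hcomp
  have hdiff : Differentiable ℝ g := fun r => (hderiv r).differentiableAt
  have hconst := is_const_of_deriv_eq_zero hdiff (fun r => (hderiv r).deriv) r 0
  simpa [hg] using hconst

/-- Polarisation of `⟪A x, x⟫ = 0`: a skew map satisfies `⟪A x, y⟫ = -⟪A y, x⟫`. [folklore] -/
theorem screwPeriod_inner_skew {A : E3 →L[ℝ] E3} (hA : ∀ x, ⟪A x, x⟫ = 0) (x y : E3) :
    ⟪A x, y⟫ = -⟪A y, x⟫ := by
  have h := hA (x + y)
  rw [map_add, inner_add_left, inner_add_right, inner_add_right, hA x, hA y] at h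
  linarith

/-- A skew map on `ℝ³` in coordinates: its matrix in the standard basis is antisymmetric with
zero diagonal, so three entries `p = (A e₁)₀`, `q = (A e₂)₀`, `r = (A e₂)₁` determine it,
`A x = (p x₁ + q x₂, −p x₀ + r x₂, −q x₀ − r x₁) = ω × x` with `ω = (−r, q, −p)`. [folklore] -/
theorem screwPeriod_skew_apply {A : E3 →L[ℝ] E3} (hA : ∀ x, ⟪A x, x⟫ = 0) :
    ∃ p q r : ℝ, ∀ x : E3, (A x) 0 = p * x 1 + q * x 2 ∧
      (A x) 1 = -(p * x 0) + r * x 2 ∧ (A x) 2 = -(q * x 0) - r * x 1 := by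
  have key : ∀ i j : Fin 3,
      (A (EuclideanSpace.single i 1)) j = -(A (EuclideanSpace.single j 1)) i := by
    intro i j
    have h := screwPeriod_inner_skew hA (EuclideanSpace.single i 1) (EuclideanSpace.single j 1)
    simp only [EuclideanSpace.inner_single_right, one_mul, conj_trivial] at h
    exact h
  have diag : ∀ i : Fin 3, (A (EuclideanSpace.single i 1)) i = 0 := fun i => by
    have h := key i i
    linarith
  refine ⟨(A (EuclideanSpace.single 1 1)) 0, (A (EuclideanSpace.single 2 1)) 0,
    (A (EuclideanSpace.single 2 1)) 1, fun x => ?_⟩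
  have hx : x = x 0 • EuclideanSpace.single 0 (1 : ℝ) + x 1 • EuclideanSpace.single 1 (1 : ℝ) +
      x 2 • EuclideanSpace.single 2 (1 : ℝ) := by
    ext i
    fin_cases i <;> simp
  have hAx : A x = x 0 • A (EuclideanSpace.single 0 1) + x 1 • A (EuclideanSpace.single 1 1) +
      x 2 • A (EuclideanSpace.single 2 1) := by
    conv_lhs => rw [hx]
    simp only [map_add, map_smul]
  have h10 := key 0 1
  have h20 := key 0 2
  have h21 := key 1 2
  refine ⟨?_, ?_, ?_⟩
  · rw [hAx]
    simp only [PiLp.add_apply, PiLp.smul_apply, smul_eq_mul, diag 0]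
    ring
  · rw [hAx]
    simp only [PiLp.add_apply, PiLp.smul_apply, smul_eq_mul, diag 1, h10]
    ring
  · rw [hAx]
    simp only [PiLp.add_apply, PiLp.smul_apply, smul_eq_mul, diag 2, h20, h21]
    ring

/-- Cayley–Hamilton for a nonzero skew map on `ℝ³`: `A³ = −ρ² A` with `ρ > 0`
(`ρ² = p² + q² + r² = ‖ω‖²`, the squared angular velocity). [folklore] -/
theorem screwPeriod_skew_cube {A : E3 →L[ℝ] E3} (hA : ∀ x, ⟪A x, x⟫ = 0) (hA0 : A ≠ 0) :
    ∃ ρ : ℝ, 0 < ρ ∧ ∀ x, A (A (A x)) = -(ρ ^ 2 • A x) := by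
  obtain ⟨p, q, r, hc⟩ := screwPeriod_skew_apply hA
  have hpos : 0 < p ^ 2 + q ^ 2 + r ^ 2 := by
    by_contra hle
    have hle' := not_lt.1 hle
    have hp : p = 0 := (pow_eq_zero_iff two_ne_zero).1
      (by linarith [sq_nonneg p, sq_nonneg q, sq_nonneg r])
    have hq : q = 0 := (pow_eq_zero_iff two_ne_zero).1
      (by linarith [sq_nonneg p, sq_nonneg q, sq_nonneg r])
    have hr : r = 0 := (pow_eq_zero_iff two_ne_zero).1
      (by linarith [sq_nonneg p, sq_nonneg q, sq_nonneg r])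
    refine hA0 (ContinuousLinearMap.ext fun x => ?_)
    obtain ⟨h0, h1, h2⟩ := hc x
    ext i
    fin_cases i <;> simp [h0, h1, h2, hp, hq, hr]
  refine ⟨Real.sqrt (p ^ 2 + q ^ 2 + r ^ 2), Real.sqrt_pos.2 hpos, fun x => ?_⟩
  rw [Real.sq_sqrt hpos.le]
  obtain ⟨h0, h1, h2⟩ := hc x
  obtain ⟨g0, g1, g2⟩ := hc (A x)
  obtain ⟨k0, k1, k2⟩ := hc (A (A x))
  ext i
  fin_cases i
  · simp only [Fin.zero_eta, Fin.isValue, PiLp.neg_apply, PiLp.smul_apply, smul_eq_mul,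
      k0, g1, g2, h0, h1, h2]
    ring
  · simp only [Fin.mk_one, Fin.isValue, PiLp.neg_apply, PiLp.smul_apply, smul_eq_mul,
      k1, g0, g2, h0, h1, h2]
    ring
  · simp only [Fin.reduceFinMk, Fin.isValue, PiLp.neg_apply, PiLp.smul_apply, smul_eq_mul,
      k2, g0, g1, h0, h1, h2]
    ring

/-- **The normalised screw integrates to a period.** For `B` skew with `B³ = −B` (unit angular
velocity) and any `b`, a differentiable field with `Df(y)[b + B y] = B f(y)` for all `y` satisfies
`f (x + 2π (b + B²b)) = f x`: one full turn of the screw flow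
`γ(θ) = x + θ b + sin θ · Bx + (1 − cos θ)(B²x + Bb) + (θ − sin θ) B²b` (Rodrigues; `γ' = b + Bγ`,
`γ 0 = x`, `γ (2π) = x + 2π(b + B²b)`), along which `w = f ∘ γ − R_θ f(x)`,
`R_θ = 1 + sin θ B + (1 − cos θ)B²`, solves `w' = Bw`, `w 0 = 0`, `‖w‖² = const`. [folklore] -/
theorem screwPeriod_periodic_of_unit_screw {B : E3 →L[ℝ] E3} (hB : ∀ x, ⟪B x, x⟫ = 0)
    (hB3 : ∀ x, B (B (B x)) = -B x) (b : E3) {f : E3 → E3} (hf : Differentiable ℝ f)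
    (hcl : ∀ y, fderiv ℝ f y (b + B y) = B (f y)) (x : E3) :
    f (x + (2 * Real.pi) • (b + B (B b))) = f x := by
  -- adapted from Theorems/SymmetricLiouville/Negative/ScrewClause.lean (`screw_equivariant`)
  -- the screw orbit through `x` (Rodrigues' formula) and its velocity `b + B γ`
  set γ : ℝ → E3 := fun θ => x + θ • b + Real.sin θ • B x +
    (1 - Real.cos θ) • (B (B x) + B b) + (θ - Real.sin θ) • B (B b) with hγ
  have hγd : ∀ θ, HasDerivAt γ (b + B (γ θ)) θ := by
    intro θ
    have h1 : HasDerivAt (fun φ : ℝ => x + φ • b) ((1 : ℝ) • b) θ :=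
      ((hasDerivAt_id' θ).smul_const b).const_add x
    have h2 : HasDerivAt (fun φ : ℝ => Real.sin φ • B x) (Real.cos θ • B x) θ :=
      (Real.hasDerivAt_sin θ).smul_const (B x)
    have h3 : HasDerivAt (fun φ : ℝ => (1 - Real.cos φ) • (B (B x) + B b))
        ((-(-Real.sin θ)) • (B (B x) + B b)) θ :=
      ((Real.hasDerivAt_cos θ).const_sub 1).smul_const _
    have h4 : HasDerivAt (fun φ : ℝ => (φ - Real.sin φ) • B (B b))
        ((1 - Real.cos θ) • B (B b)) θ :=
      ((hasDerivAt_id' θ).fun_sub (Real.hasDerivAt_sin θ)).smul_const _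
    refine (((h1.add h2).add h3).add h4).congr_deriv ?_
    simp only [hγ, map_add, map_smul, hB3]
    module
  -- `R_θ v = v + sin θ • Bv + (1 − cos θ) • B²v` solves `R' = B R`, `R_0 = 1`, `R_{2π} = 1`
  set R : E3 → ℝ → E3 := fun v θ => v + Real.sin θ • B v + (1 - Real.cos θ) • B (B v) with hR
  have hRd : ∀ v θ, HasDerivAt (R v) (B (R v θ)) θ := by
    intro v θ
    have h2 : HasDerivAt (fun φ : ℝ => Real.sin φ • B v) (Real.cos θ • B v) θ :=
      (Real.hasDerivAt_sin θ).smul_const (B v)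
    have h3 : HasDerivAt (fun φ : ℝ => (1 - Real.cos φ) • B (B v))
        ((-(-Real.sin θ)) • B (B v)) θ :=
      ((Real.hasDerivAt_cos θ).const_sub 1).smul_const _
    refine ((h2.const_add v).add h3).congr_deriv ?_
    simp only [hR, map_add, map_smul, hB3]
    module
  -- `w = f ∘ γ − R_θ f(x)` solves `w' = B w`
  set w : ℝ → E3 := fun θ => f (γ θ) - R (f x) θ with hw
  have hwd : ∀ θ, HasDerivAt w (B (w θ)) θ := by
    intro θ
    have hu1 : HasDerivAt (fun φ => f (γ φ)) (fderiv ℝ f (γ θ) (b + B (γ θ))) θ :=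
      (hf (γ θ)).hasFDerivAt.comp_hasDerivAt θ (hγd θ)
    rw [hcl (γ θ)] at hu1
    have h3 := hu1.fun_sub (hRd (f x) θ)
    rw [← map_sub] at h3
    exact h3
  -- `‖w‖²` is constant (`B` is skew) and `w 0 = 0`, so `w (2π) = 0`
  have hn : ∀ θ, HasDerivAt (fun φ => ⟪w φ, w φ⟫) 0 θ := by
    intro θ
    have h1 := (hwd θ).inner ℝ (hwd θ)
    have e : ⟪w θ, B (w θ)⟫ + ⟪B (w θ), w θ⟫ = 0 := by
      rw [real_inner_comm, hB, add_zero]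
    rwa [e] at h1
  have hconst : ∀ θ, ⟪w θ, w θ⟫ = ⟪w 0, w 0⟫ := fun θ =>
    is_const_of_deriv_eq_zero (fun ψ => (hn ψ).differentiableAt) (fun ψ => (hn ψ).deriv) θ 0
  have hw0 : w 0 = 0 := by simp [hw, hγ, hR]
  have hwT : w (2 * Real.pi) = 0 := by
    have h1 := hconst (2 * Real.pi)
    rw [hw0, inner_zero_left, real_inner_self_eq_norm_sq] at h1
    have : ‖w (2 * Real.pi)‖ = 0 := by nlinarith [norm_nonneg (w (2 * Real.pi))]
    exact norm_eq_zero.1 this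
  -- one full turn: `γ (2π) = x + L`, `R_{2π} = 1`
  have hγT : γ (2 * Real.pi) = x + (2 * Real.pi) • (b + B (B b)) := by
    simp only [hγ, Real.sin_two_pi, Real.cos_two_pi]
    module
  have hRT : R (f x) (2 * Real.pi) = f x := by
    simp only [hR, Real.sin_two_pi, Real.cos_two_pi]
    module
  have key : f (γ (2 * Real.pi)) - R (f x) (2 * Real.pi) = 0 := hwT
  rwa [hγT, hRT, sub_eq_zero] at key

/-- **Stub 1 (screw ⊃ lattice).** For a skew `A` on `ℝ³` and `a ∉ range A` there is ONE vector
`L ≠ 0` such that every differentiable field annihilated by the Killing generator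
`(a + Ax)·∇ − A` is `L`-periodic (`L = a` if `A = 0`; otherwise `A³ = −ρ²A`, Rodrigues' formula
for the screw flow, one full turn `2π/ρ` is the translation by `L = (2π/ρ)(a + ρ⁻²A²a) ∈ ker A`,
and `u ∘ Φ_s − e^{sA}u` solves `w' = Aw`, `w(0) = 0`, with `A` skew). [folklore] -/
theorem stub_helicalScrewPeriod :
    ∀ (a : E3) (A : E3 →L[ℝ] E3), (∀ x, inner ℝ (A x) x = 0) → a ∉ Set.range A →
      ∃ L : E3, L ≠ 0 ∧ ∀ (f : E3 → E3), Differentiable ℝ f →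
        (∀ x, fderiv ℝ f x (a + A x) - A (f x) = 0) → ∀ x, f (x + L) = f x := by
  intro a A hA ha
  by_cases hA0 : A = 0
  · -- a translation: `L = a ≠ 0`
    subst hA0
    have ha0 : a ≠ 0 := by
      rintro rfl
      exact ha ⟨0, by simp⟩
    refine ⟨a, ha0, fun f hf hcl x => ?_⟩
    have h : ∀ y, fderiv ℝ f y a = 0 := fun y => by simpa using hcl y
    simpa using screwPeriod_eq_of_fderiv_apply_eq_zero hf h x 1
  · -- a screw motion of nonzero pitch: `A³ = -ρ² A`; normalise the angular velocity to `1`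
    obtain ⟨ρ, hρ, hA3⟩ := screwPeriod_skew_cube hA hA0
    have hρ0 : ρ ≠ 0 := hρ.ne'
    obtain ⟨B, hB⟩ : ∃ B : E3 →L[ℝ] E3, B = ρ⁻¹ • A := ⟨_, rfl⟩
    obtain ⟨b, hb⟩ : ∃ b : E3, b = ρ⁻¹ • a := ⟨_, rfl⟩
    have hBx : ∀ x, B x = ρ⁻¹ • A x := fun x => by rw [hB]; rfl
    have hBskew : ∀ x, ⟪B x, x⟫ = 0 := fun x => by
      rw [hBx, real_inner_smul_left, hA x, mul_zero]
    have hB3 : ∀ x, B (B (B x)) = -B x := fun x => by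
      simp only [hBx, map_smul, hA3, smul_neg, smul_smul]
      match_scalars
      field_simp
    have hL : (2 * Real.pi) • (b + B (B b)) ≠ 0 := by
      intro h0
      rcases smul_eq_zero.1 h0 with h0 | h0
      · exact Real.two_pi_pos.ne' h0
      · refine ha ⟨-B b, ?_⟩
        have hb' : b = -B (B b) := eq_neg_of_add_eq_zero_left h0
        calc A (-B b) = ρ • B (-B b) := by
              rw [hBx (-B b), smul_smul, mul_inv_cancel₀ hρ0, one_smul]
          _ = ρ • b := by rw [map_neg, ← hb']
          _ = a := by rw [hb, smul_smul, mul_inv_cancel₀ hρ0, one_smul]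
    refine ⟨(2 * Real.pi) • (b + B (B b)), hL, fun f hf hcl x => ?_⟩
    have hclB : ∀ y, fderiv ℝ f y (b + B y) = B (f y) := fun y => by
      have h1 : fderiv ℝ f y (a + A y) = A (f y) := sub_eq_zero.1 (hcl y)
      rw [hBx y, hBx (f y), hb, ← smul_add, map_smul, h1]
    exact screwPeriod_periodic_of_unit_screw hBskew hB3 b hf hclB x

end Summit.NavierStokesRegularity.NavierStokesRegularity.Theorems

end
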